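import Literature.NumberTheory.Transcendental.AperyTableBounds
import Literature.NumberTheory.LFunctions.LcmUptoCubeBound
import Literature.NumberTheory.Transcendental.PeriodsWave0
import HarnessLib

/-!
# Apéry's theorem: `ζ(3)` is irrational

The analytic end of Apéry's second proof (Apéry 1981; Rajkumar 2012, arXiv:1212.5881, §§2–3)
for `ζ(3) = zetaValue 3 = ∑ n⁻³` of `PeriodsWave0.lean`, built on the tables `pT`, `qT` of
`AperyTable.lean` / `AperyTableBounds.lean`:

* `tendsto_ratio` (Rajkumar Prop. 3): every row of ratios `r_{i,j} = p_{i,j}/q_{i,j}` tends to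
  `ζ(3)` (row `0` is `H₃(j) → ζ(3)`; `r_{i+1,j} - r_{i,j} = 1/((i+1)³ q_{i+1,j} q_{i,j}) → 0`);
* `eps_bounds`: along the diagonal, `εₙ = q_{n,n} ζ(3) - p_{n,n}` satisfies
  `0 < εₙ ≤ ζ(3)/q_{n,n}` (`r_{n,j}` increases in `j` by `1/((j+1)³ q_{n,j+1} q_{n,j})`);
* `irrational_zeta_three`: if `ζ(3) = a/b` then `b dₙ³ εₙ` (`dₙ = lcm(1..n)`) is a positive
  integer (Prop. 2: `q_{n,n}, dₙ³ p_{n,n} ∈ ℤ`), but `dₙ³ ≤ K 32ⁿ`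
  (`LcmUptoCubeBound.lean`) and `q_{n,n} ≥ 33^{n-62}` (`AperyTableBounds.lean`) force it below
  `1` — Rajkumar's §3 with Poincaré–Perron replaced by the explicit growth bound and the prime
  number theorem replaced by Chebyshev's bound.

The discharge `irrational_zetaValue_three_holds` of **periods.S18** is in
`PeriodsWave0Proofs.lean`.

## References
* [Apery1979] R. Apéry, Irrationalité de `ζ(2)` et `ζ(3)`, Astérisque 61 (1979) 11–13.
* [Apery1981] R. Apéry, Interpolation de fractions continues…, Bull. Sect. Sci. C.T.H.S. III (1981).
* [Rajkumar2012] K. Rajkumar, arXiv:1212.5881, §2 Prop. 3, §3.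
* [VanDerPoorten1979] A. van der Poorten, A proof that Euler missed…, Math. Intelligencer 1 (1979).
-/

noncomputable section

open Filter Finset
open scoped Topology

namespace Literature.NumberTheory.Transcendental

namespace Apery

/-! ### `ζ(3)` and the partial sums `H₃` -/

/-- `∑ m⁻³` converges. [folklore] -/
theorem summable_one_div_cube : Summable (fun m : ℕ => 1 / (m : ℝ) ^ 3) :=
  Real.summable_one_div_nat_pow.mpr (by norm_num)

/-- `H₃(j)` as a real number is the partial sum `∑_{m ≤ j} m⁻³` of the series defining
`zetaValue 3` (whose `m = 0` term is `0`). [folklore] -/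
theorem H3_cast (j : ℕ) : ((H3 j : ℚ) : ℝ) = ∑ m ∈ range (j + 1), 1 / (m : ℝ) ^ 3 := by
  rw [Finset.sum_range_succ']
  simp [H3]

/-- `H₃(j) → ζ(3)`. [folklore] -/
theorem tendsto_H3 : Tendsto (fun j : ℕ => ((H3 j : ℚ) : ℝ)) atTop (𝓝 (zetaValue 3)) := by
  have h := summable_one_div_cube.hasSum.tendsto_sum_nat
  have h2 := h.comp (tendsto_add_atTop_nat 1)
  have e : (fun j : ℕ => ((H3 j : ℚ) : ℝ)) =
      (fun n : ℕ => ∑ m ∈ range n, 1 / (m : ℝ) ^ 3) ∘ fun j => j + 1 := by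
    funext j
    simp [H3_cast]
  rw [e, zetaValue]
  exact h2

/-- `H₃(j) ≤ ζ(3)`. [folklore] -/
theorem H3_le_zeta (j : ℕ) : ((H3 j : ℚ) : ℝ) ≤ zetaValue 3 := by
  rw [H3_cast, zetaValue]
  exact summable_one_div_cube.sum_le_tsum (range (j + 1)) fun m _ => by positivity

/-- `0 ≤ H₃(j)`. [folklore] -/
theorem H3_nonneg (j : ℕ) : (0 : ℝ) ≤ ((H3 j : ℚ) : ℝ) := by
  rw [H3_cast]
  exact sum_nonneg fun m _ => by positivity

/-- `0 < ζ(3)`. [folklore] -/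
theorem zeta_three_pos : 0 < zetaValue 3 := by
  have h := H3_le_zeta 1
  have e : ((H3 1 : ℚ) : ℝ) = 1 := by
    rw [show (1 : ℕ) = 0 + 1 from rfl, H3_succ, H3_zero]; norm_num
  linarith

/-! ### Limits along the rows -/

/-- `0 < q_{i,j}` in `ℝ`. [cite: Rajkumar2012, §2 Prop. 3 (proof)] -/
theorem qT_pos_real (i j : ℕ) : (0 : ℝ) < qT i j := by exact_mod_cast qT_pos i j

/-- `r_{i,j+1} - r_{i,j} = 1/((j+1)³ q_{i,j+1} q_{i,j})` (row Casoratian). [cite: Rajkumar2012, §2 Prop. 3 (proof)] -/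
theorem ratio_succ_sub (i j : ℕ) :
    (pT i (j + 1) : ℝ) / qT i (j + 1) - pT i j / qT i j =
      1 / (((j : ℝ) + 1) ^ 3 * qT i (j + 1) * qT i j) := by
  have hc : (pT i (j + 1) : ℝ) * qT i j - pT i j * qT i (j + 1) = 1 / ((j : ℝ) + 1) ^ 3 := by
    have h := congrArg (Rat.cast : ℚ → ℝ) (casoratian_row i j)
    push_cast at h
    exact h
  have hc' : ((pT i (j + 1) : ℝ) * qT i j - pT i j * qT i (j + 1)) * ((j : ℝ) + 1) ^ 3 = 1 := by
    rw [hc]; field_simp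
  have hq1 := qT_pos_real i (j + 1)
  have hq0 := qT_pos_real i j
  rw [div_sub_div _ _ hq1.ne' hq0.ne', div_eq_div_iff (by positivity) (by positivity)]
  linear_combination ((qT i (j + 1) : ℝ) * qT i j) * hc'

/-- `r_{i+1,j} = r_{i,j} + 1/((i+1)³ q_{i+1,j} q_{i,j})` (column Casoratian). [cite: Rajkumar2012, §2 Prop. 3 (proof)] -/
theorem ratio_succ_left (i j : ℕ) :
    (pT (i + 1) j : ℝ) / qT (i + 1) j =
      pT i j / qT i j + 1 / (((i : ℝ) + 1) ^ 3 * qT (i + 1) j * qT i j) := by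
  have hc : (pT (i + 1) j : ℝ) * qT i j - pT i j * qT (i + 1) j = 1 / ((i : ℝ) + 1) ^ 3 := by
    have h := congrArg (Rat.cast : ℚ → ℝ) (casoratian_col i j)
    push_cast at h
    exact h
  have hc' : ((pT (i + 1) j : ℝ) * qT i j - pT i j * qT (i + 1) j) * ((i : ℝ) + 1) ^ 3 = 1 := by
    rw [hc]; field_simp
  have hq1 := qT_pos_real (i + 1) j
  have hq0 := qT_pos_real i j
  have hdiff : (pT (i + 1) j : ℝ) / qT (i + 1) j - pT i j / qT i j =
      1 / (((i : ℝ) + 1) ^ 3 * qT (i + 1) j * qT i j) := by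
    rw [div_sub_div _ _ hq1.ne' hq0.ne', div_eq_div_iff (by positivity) (by positivity)]
    linear_combination ((qT (i + 1) j : ℝ) * qT i j) * hc'
  linarith

/-- **Rajkumar's Proposition 3**: every row of ratios `p_{i,j}/q_{i,j}` tends to `ζ(3)` as `j → ∞`
(induction on `i`; the correction `1/((i+1)³ q_{i+1,j} q_{i,j}) ≤ 1/(j+1) → 0`).
[cite: Rajkumar2012, §2 Prop. 3] -/
theorem tendsto_ratio (i : ℕ) :
    Tendsto (fun j : ℕ => (pT i j : ℝ) / qT i j) atTop (𝓝 (zetaValue 3)) := by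
  induction i with
  | zero => simpa using tendsto_H3
  | succ i ih =>
    have hT : Tendsto (fun j : ℕ => 1 / (((i : ℝ) + 1) ^ 3 * qT (i + 1) j * qT i j))
        atTop (𝓝 0) := by
      refine squeeze_zero (fun j => ?_) (fun j => ?_) tendsto_one_div_add_atTop_nhds_zero_nat
      · have := qT_pos_real (i + 1) j
        have := qT_pos_real i j
        positivity
      · have hq1 := qT_pos_real (i + 1) j
        have hq0 := qT_pos_real i j
        have h1 : (j : ℝ) + 1 ≤ qT (i + 1) j := by exact_mod_cast succ_le_qT_succ i j
        have h2 : (1 : ℝ) ≤ qT i j := by exact_mod_cast one_le_qT i j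
        have h3 : (1 : ℝ) ≤ ((i : ℝ) + 1) ^ 3 := one_le_pow₀ (by linarith [(Nat.cast_nonneg i : (0:ℝ) ≤ i)])
        have h4 : (j : ℝ) + 1 ≤ ((i : ℝ) + 1) ^ 3 * qT (i + 1) j * qT i j := by
          calc (j : ℝ) + 1 = 1 * ((j : ℝ) + 1) * 1 := by ring
            _ ≤ ((i : ℝ) + 1) ^ 3 * qT (i + 1) j * qT i j := by
              gcongr
        exact one_div_le_one_div_of_le (by positivity) h4
    have e : (fun j : ℕ => (pT (i + 1) j : ℝ) / qT (i + 1) j) =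
        fun j => pT i j / qT i j + 1 / (((i : ℝ) + 1) ^ 3 * qT (i + 1) j * qT i j) := by
      funext j; exact ratio_succ_left i j
    rw [e]
    simpa using ih.add hT

/-! ### The diagonal forms `ε_n = q_{n,n} ζ(3) - p_{n,n}` -/

/-- `j ↦ r_{n,j}` is monotone. [cite: Rajkumar2012, §2 Prop. 3 (proof)] -/
theorem ratio_mono (n : ℕ) : Monotone fun j : ℕ => (pT n j : ℝ) / qT n j := by
  refine monotone_nat_of_le_succ fun j => ?_
  have h := ratio_succ_sub n j
  have : 0 < 1 / (((j : ℝ) + 1) ^ 3 * qT n (j + 1) * qT n j) := by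
    have := qT_pos_real n (j + 1)
    have := qT_pos_real n j
    positivity
  linarith

/-- `r_{n,J} - r_{n,n} ≤ (H₃(J) - H₃(n))/q_{n,n}²` for `J ≥ n` (each increment is
`≤ 1/((j+1)³ q_{n,n}²)` by row-monotonicity of `q`). [cite: Rajkumar2012, §2 Prop. 3 (proof, last display)] -/
theorem ratio_sub_le (n : ℕ) {J : ℕ} (hJ : n ≤ J) :
    (pT n J : ℝ) / qT n J - pT n n / qT n n ≤
      (((H3 J : ℚ) : ℝ) - ((H3 n : ℚ) : ℝ)) / (qT n n : ℝ) ^ 2 := by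
  induction J, hJ using Nat.le_induction with
  | base => simp
  | succ J hJ ih =>
    have hd := ratio_succ_sub n J
    have hq := qT_pos_real n n
    have hq' : (qT n n : ℝ) ≠ 0 := hq.ne'
    have hqJ1 := qT_pos_real n (J + 1)
    have hqJ := qT_pos_real n J
    have hm1 : (qT n n : ℝ) ≤ qT n (J + 1) := by exact_mod_cast qT_mono_right n (by omega)
    have hm0 : (qT n n : ℝ) ≤ qT n J := by exact_mod_cast qT_mono_right n hJ
    have hstep : 1 / (((J : ℝ) + 1) ^ 3 * qT n (J + 1) * qT n J) ≤
        1 / (((J : ℝ) + 1) ^ 3 * qT n n * qT n n) := by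
      apply one_div_le_one_div_of_le (by positivity)
      gcongr
    have hH : ((H3 (J + 1) : ℚ) : ℝ) = ((H3 J : ℚ) : ℝ) + 1 / ((J : ℝ) + 1) ^ 3 := by
      rw [H3_succ]; push_cast; ring
    rw [hH]
    have e : 1 / (((J : ℝ) + 1) ^ 3 * qT n n * qT n n) = (1 / ((J : ℝ) + 1) ^ 3) / (qT n n : ℝ) ^ 2 := by
      field_simp
    rw [e] at hstep
    have : (pT n (J + 1) : ℝ) / qT n (J + 1) - pT n n / qT n n =
        ((pT n (J + 1) : ℝ) / qT n (J + 1) - pT n J / qT n J) + (pT n J / qT n J - pT n n / qT n n) := by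
      ring
    rw [this, hd]
    calc 1 / (((J : ℝ) + 1) ^ 3 * qT n (J + 1) * qT n J) + (pT n J / qT n J - pT n n / qT n n)
        ≤ (1 / ((J : ℝ) + 1) ^ 3) / (qT n n : ℝ) ^ 2
          + (((H3 J : ℚ) : ℝ) - ((H3 n : ℚ) : ℝ)) / (qT n n : ℝ) ^ 2 := add_le_add hstep ih
      _ = (((H3 J : ℚ) : ℝ) + 1 / ((J : ℝ) + 1) ^ 3 - ((H3 n : ℚ) : ℝ)) / (qT n n : ℝ) ^ 2 := by
          ring

/-- **The linear forms**: `0 < εₙ = q_{n,n} ζ(3) - p_{n,n} ≤ ζ(3)/q_{n,n}`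
(`|ζ(3) - r_{n,n}| ≤ q_{n,n}⁻² ∑_{k>n} k⁻³` and `ζ(3) - r_{n,n} ≥ r_{n,n+1} - r_{n,n} > 0`).
[cite: Rajkumar2012, §2 Prop. 3] -/
theorem eps_bounds (n : ℕ) :
    0 < (qT n n : ℝ) * zetaValue 3 - pT n n ∧
      (qT n n : ℝ) * zetaValue 3 - pT n n ≤ zetaValue 3 / qT n n := by
  have hq := qT_pos_real n n
  have hlim := tendsto_ratio n
  -- lower bound: ζ(3) ≥ r_{n,n+1} > r_{n,n}
  have hge : (pT n (n + 1) : ℝ) / qT n (n + 1) ≤ zetaValue 3 :=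
    ge_of_tendsto hlim (eventually_atTop.2 ⟨n + 1, fun J hJ => ratio_mono n hJ⟩)
  have hgap : 0 < (pT n (n + 1) : ℝ) / qT n (n + 1) - pT n n / qT n n := by
    rw [ratio_succ_sub]
    have := qT_pos_real n (n + 1)
    positivity
  -- upper bound: pass to the limit in `ratio_sub_le`
  have hle : zetaValue 3 - pT n n / qT n n ≤
      (zetaValue 3 - ((H3 n : ℚ) : ℝ)) / (qT n n : ℝ) ^ 2 := by
    have h1 : Tendsto (fun J : ℕ => (pT n J : ℝ) / qT n J - pT n n / qT n n) atTop
        (𝓝 (zetaValue 3 - pT n n / qT n n)) := hlim.sub_const _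
    have h2 : Tendsto (fun J : ℕ => (((H3 J : ℚ) : ℝ) - ((H3 n : ℚ) : ℝ)) / (qT n n : ℝ) ^ 2)
        atTop (𝓝 ((zetaValue 3 - ((H3 n : ℚ) : ℝ)) / (qT n n : ℝ) ^ 2)) :=
      (tendsto_H3.sub_const _).div_const _
    exact le_of_tendsto_of_tendsto h1 h2 (eventually_atTop.2 ⟨n, fun J hJ => ratio_sub_le n hJ⟩)
  have hH0 := H3_nonneg n
  have hZ := zeta_three_pos
  constructor
  · have : 0 < zetaValue 3 - pT n n / qT n n := by linarith
    have e : (qT n n : ℝ) * zetaValue 3 - pT n n = qT n n * (zetaValue 3 - pT n n / qT n n) := by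
      field_simp
    rw [e]; positivity
  · have e : (qT n n : ℝ) * zetaValue 3 - pT n n = qT n n * (zetaValue 3 - pT n n / qT n n) := by
      field_simp
    rw [e]
    calc (qT n n : ℝ) * (zetaValue 3 - pT n n / qT n n)
        ≤ qT n n * ((zetaValue 3 - ((H3 n : ℚ) : ℝ)) / (qT n n : ℝ) ^ 2) := by gcongr
      _ ≤ qT n n * (zetaValue 3 / (qT n n : ℝ) ^ 2) := by gcongr; linarith
      _ = zetaValue 3 / qT n n := by field_simp

/-! ### Apéry's theorem -/

/-- **Apéry's theorem** (Apéry 1979, *Astérisque* 61): `ζ(3) = ∑ n⁻³` is irrational. Proof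
(Apéry 1981 / Rajkumar 2012, §3): with `ζ(3) = a/b`, `n = 62 + m`, the number
`b dₙ³ εₙ = dₙ³ q_{n,n} a - b dₙ³ p_{n,n}` is a positive integer, yet
`≤ b dₙ³ ζ(3)/q_{n,n} ≤ b K ζ(3) 32⁶² (32/33)^m < 1` for `m` large. [cite: Apery1979, Astérisque 61 (Théorème)] -/
theorem irrational_zeta_three : Irrational (zetaValue 3) := by
  rintro ⟨r, hr⟩
  obtain ⟨K, hK, hKb⟩ := Literature.NumberTheory.LFunctions.exists_lcmUpto_pow_three_le
  have hZ := zeta_three_pos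
  have hden : (0 : ℝ) < r.den := by exact_mod_cast r.den_pos
  have hnum : zetaValue 3 * r.den = r.num := by
    rw [← hr]; exact_mod_cast Rat.mul_den_eq_num r
  have hKr : (0 : ℝ) < K := by exact_mod_cast hK
  -- choose `m` with `den · K · ζ(3) · 32⁶² · (32/33)^m < 1`
  obtain ⟨m, hm⟩ := exists_pow_lt_of_lt_one
    (show (0 : ℝ) < 1 / (r.den * K * zetaValue 3 * 32 ^ 62) by positivity)
    (show (32 : ℝ) / 33 < 1 by norm_num)
  -- the data at `n = 62 + m`
  obtain ⟨Q, hQ⟩ := qT_isInt (62 + m) (62 + m)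
  obtain ⟨P, hP⟩ := lcmUpto_cube_mul_pT_isInt (62 + m) (62 + m) (62 + m) le_rfl le_rfl
  obtain ⟨hε0, hε1⟩ := eps_bounds (62 + m)
  have hq := qT_pos_real (62 + m) (62 + m)
  have hQr : ((qT (62 + m) (62 + m) : ℚ) : ℝ) = (Q : ℝ) := by
    rw [hQ]; exact Rat.cast_intCast Q
  have hPr : (Nat.lcmUpto (62 + m) : ℝ) ^ 3 * ((pT (62 + m) (62 + m) : ℚ) : ℝ) = (P : ℝ) := by
    have h := congrArg (Rat.cast : ℚ → ℝ) hP
    push_cast at h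
    exact h
  have hd : (0 : ℝ) < (Nat.lcmUpto (62 + m) : ℝ) := by exact_mod_cast Nat.lcmUpto_pos _
  have hdK : (Nat.lcmUpto (62 + m) : ℝ) ^ 3 ≤ (K : ℝ) * 32 ^ (62 + m) := by
    exact_mod_cast hKb (62 + m)
  have hgrow : (33 : ℝ) ^ m ≤ qT (62 + m) (62 + m) := by
    have h1 : (33 : ℚ) ^ m * qT 62 62 ≤ qT (62 + m) (62 + m) := pow_mul_qT_le m
    have h2 : (1 : ℚ) ≤ qT 62 62 := one_le_qT 62 62
    have h3 : (33 : ℚ) ^ m ≤ qT (62 + m) (62 + m) :=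
      le_trans (le_mul_of_one_le_right (by positivity) h2) h1
    exact_mod_cast h3
  -- the integer `E = den · d³ · ε_n`
  have hEint : (r.den : ℝ) * (Nat.lcmUpto (62 + m) : ℝ) ^ 3
        * ((qT (62 + m) (62 + m) : ℝ) * zetaValue 3 - pT (62 + m) (62 + m)) =
      ((Nat.lcmUpto (62 + m) ^ 3 * Q * r.num - r.den * P : ℤ) : ℝ) := by
    push_cast
    rw [← hPr, ← hQr, ← hnum]
    ring
  have hEpos : 0 < (r.den : ℝ) * (Nat.lcmUpto (62 + m) : ℝ) ^ 3
      * ((qT (62 + m) (62 + m) : ℝ) * zetaValue 3 - pT (62 + m) (62 + m)) :=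
    mul_pos (mul_pos hden (pow_pos hd 3)) hε0
  have hElt : (r.den : ℝ) * (Nat.lcmUpto (62 + m) : ℝ) ^ 3
      * ((qT (62 + m) (62 + m) : ℝ) * zetaValue 3 - pT (62 + m) (62 + m)) < 1 := by
    calc (r.den : ℝ) * (Nat.lcmUpto (62 + m) : ℝ) ^ 3
          * ((qT (62 + m) (62 + m) : ℝ) * zetaValue 3 - pT (62 + m) (62 + m))
        ≤ (r.den : ℝ) * (Nat.lcmUpto (62 + m) : ℝ) ^ 3
          * (zetaValue 3 / qT (62 + m) (62 + m)) := by gcongr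
      _ ≤ r.den * ((K : ℝ) * 32 ^ (62 + m)) * (zetaValue 3 / (33 : ℝ) ^ m) := by gcongr
      _ = r.den * K * zetaValue 3 * 32 ^ 62 * ((32 : ℝ) / 33) ^ m := by
          rw [pow_add, div_pow]; ring
      _ < r.den * K * zetaValue 3 * 32 ^ 62 * (1 / (r.den * K * zetaValue 3 * 32 ^ 62)) := by
          gcongr
      _ = 1 := by field_simp
  rw [hEint] at hEpos hElt
  have h1 : (0 : ℤ) < Nat.lcmUpto (62 + m) ^ 3 * Q * r.num - r.den * P := by exact_mod_cast hEpos
  have h2 : Nat.lcmUpto (62 + m) ^ 3 * Q * r.num - r.den * P < (1 : ℤ) := by exact_mod_cast hElt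
  linarith

end Apery

end Literature.NumberTheory.Transcendental
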